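import Summits.BirchSwinnertonDyer.BirchSwinnertonDyer.Theorems.TwoAdicConverseOrdLambdaHalfAtTwoGreenbergWbarTwist
import Summits.BirchSwinnertonDyer.BirchSwinnertonDyer.Theorems.PrintCFramBottomClassIndexLawFiveLeHerbrandSelmerToHomPrimes
import Summits.BirchSwinnertonDyer.BirchSwinnertonDyer.Theorems.TwoAdicConverseOrdLambdaHalfAtTwoWbarLayerInduction
import Summits.BirchSwinnertonDyer.Rank1Residual.X11b.InertiaTransport
import HarnessLib

/-!
# Route `TwoAdicConverse` (rung S3), crux `OrdLambdaHalfAtTwo` (item stmt-BirchSwinnertonDyer-19556), line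
# `kato-determinant-greenberg-two`, stub `stub_wbarStepAtTwo` ([C]) — brick L: the local conditions of the stub on an explicit
# cocycle, in the currency of primes of `\bar ℤ_K`, and the transport of inertia from `Γ_ℚ` to `Γ_K`

Cell `bsd-2adic`, seat `bsd-2adic-conv-1` GEN 26 (`--supports` stmt-BirchSwinnertonDyer-19556, helper; pen RC-325, (h1)).  For a normal
`H ≤ Γ_K`, a discrete `Γ_K`-module `M` with TRIVIAL action and a continuous cocycle `z : H → M` (= continuous homomorphism):
* `smul_eq_self_of_card_eq_two` — a `Γ_K`-module of order `2` has trivial action;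
* `apply_eq_zero_of_forall_conjH1_mem_unramifiedKer` — «every conjugate `conj_σ [z]` is unramified at `v`» ⟹ `z` kills `H ∩ I_𝔓`
  for EVERY prime `𝔓` of `\bar ℤ_K` above `v`; `conjH1_mem_unramifiedKer_of_forall_primesAbove` — the converse;
* `apply_eq_zero_of_forall_conjH1_mem_strictKer_bdpData` — «every conjugate is strict at `w`» (Castella's datum `bdpData`) ⟹ `z`
  kills `H ∩ D_𝔔` for every prime `𝔔` above `w`;
* `apply_eq_zero_of_absGaloisRestrict_mem_inertia` — TRANSPORT: if `z` kills `H ∩ I_𝔓` for every prime of `\bar ℤ_K` above every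
  place `∌ p`, then `z x = 0` whenever `res x ∈ Γ_ℚ` lies in the inertia group of a prime of `\bar ℤ` above a rational place `∌ p`
  (tree `X11b.InertiaTransport`: transport along `absGaloisTransport` and re-basing `𝓞 ℚ ⊂ 𝓞 K`).
Dictionary σ-form ⟺ prime-form: tree `PrintCFram.HerbrandSelmerToHom.forall_primesAbove_…` / `forall_conj_…` (Neukirch I (9.1), (9.4)).

HONEST FRAMING: theorems only (no definition, no named fact, no `sorry`); Galois-cohomological bookkeeping; BSD is not proved by
any of this.  PARTITION (D-0054): none — RANK axis S3 × X5@2 stratum (β); types-the-object-of (stub 3b-C).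
References: [cite: NeukirchANT1999, Ch. I §9 (9.1), (9.4)]; [cite: GreenbergVatsal2000, §2 pp. 16–17]; [cite: Greenberg1989, §1 p. 98].
-/

set_option autoImplicit false
-- the route's Theorems namespace repeats the summit name by design (D-0017 nested layout)
set_option linter.dupNamespace false

noncomputable section

open scoped Classical NumberField Pointwise

namespace Summit.BirchSwinnertonDyer.BirchSwinnertonDyer.Theorems.TwoAdicWbarStep

open Function NumberField IsDedekindDomain Field
  Literature.NumberTheory.GaloisRepresentations Literature.NumberTheory.EllipticCurves
  Literature.NumberTheory.EllipticCurves.GreenbergSelmer Literature.NumberTheory.EllipticCurves.GreenbergVatsal2000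
  Literature.NumberTheory.EllipticCurves.CocycleCriteria
  Summit.BirchSwinnertonDyer.Rank1Residual.X11b Summit.BirchSwinnertonDyer.Rank1Residual.X11b.AcSelmer
  Summit.BirchSwinnertonDyer.BirchSwinnertonDyer.Theorems.TwoAdicGreenbergCotorsion
  Summit.BirchSwinnertonDyer.BirchSwinnertonDyer.Theorems.PrintCFram.HerbrandSelmerToHom

variable {K : Type} [Field K] [NumberField K] (H : Subgroup (absoluteGaloisGroup K)) [H.Normal]
  {M : Type} [AddCommGroup M] [DistribMulAction (absoluteGaloisGroup K) M] [TopologicalSpace M] [DiscreteTopology M]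

/-! ## §1. Modules of order `2` have trivial action -/

omit [NumberField K] [TopologicalSpace M] [DiscreteTopology M] in
/-- A `Γ_K`-module of order `2` carries the trivial action (an additive bijection fixes `0`, hence the other element). [folklore] -/
theorem smul_eq_self_of_card_eq_two (hM : Nat.card M = 2) (σ : absoluteGaloisGroup K) (m : M) : σ • m = m := by
  by_cases hm : m = 0
  · rw [hm, smul_zero]
  · have hne : σ • m ≠ 0 := fun h ↦ hm (by
      have h' := congrArg (fun x ↦ σ⁻¹ • x) h
      simpa only [inv_smul_smul, smul_zero] using h')
    exact eq_of_ne_zero_of_card_eq_two hM hne hm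

/-! ## §2. The unramified condition on an explicit cocycle, prime by prime -/

set_option synthInstance.maxHeartbeats 100000 in
-- the pointwise `MulAction` of `Γ_K` on the ideals of `\bar ℤ_K` is found slowly under these imports (as in `…SelmerToHomPrimes`)
/-- **σ-form ⟹ prime-form for the unramified condition.**  If every conjugate `conj_σ [z]` of the class of the cocycle `z` lies in
`unramifiedKer H M v` (trivial action), then `z` vanishes on `H ∩ I_𝔓` for every prime `𝔓` of `\bar ℤ_K` above `v`.
[cite: GreenbergVatsal2000, §2 p. 17] [cite: NeukirchANT1999, Ch. I §9 (9.1)] -/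
theorem apply_eq_zero_of_forall_conjH1_mem_unramifiedKer (htriv : ∀ (σ : absoluteGaloisGroup K) (m : M), σ • m = m)
    (z : contOneCocycles (discreteTopRep H M)) {v : HeightOneSpectrum (𝓞 K)}
    (h : ∀ σ : absoluteGaloisGroup K, conjH1 H M σ (oneCocycleClass _ z) ∈ unramifiedKer H M v)
    {𝔓 : Ideal (absIntegers (𝓞 K) K)} (h𝔓 : 𝔓 ∈ v.primesAbove) {n : absoluteGaloisGroup K} (hnH : n ∈ H)
    (hn : n ∈ 𝔓.inertia (absoluteGaloisGroup K)) : z.1 ⟨n, hnH⟩ = 0 := by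
  revert hnH
  refine forall_primesAbove_inertia_of_forall_conj (v := v) (fun m ↦ ∀ hm : m ∈ H, z.1 ⟨m, hm⟩ = 0) ?_ h𝔓 hn
  intro σ m hσm hmH
  -- `x = σ m σ⁻¹ ∈ H ∩ I_v`, an element of `inertiaIn H v`
  have hxH : σ * m * σ⁻¹ ∈ H := ‹H.Normal›.conj_mem m hmH σ
  let x : inertiaIn H v := ⟨⟨σ * m * σ⁻¹, inertia_le_decomp v hσm⟩, (mem_inertiaIn_iff H v _).mpr ⟨hxH, hσm⟩⟩
  have hmem := h σ
  have e : unramifiedKer H M v = (resH1Hom (inertiaInToH H v) (AddMonoidHom.id M) fun _ _ ↦ rfl).ker := rfl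
  rw [e, AddMonoidHom.mem_ker] at hmem
  change resH1Hom (inertiaInToH H v) (AddMonoidHom.id M) _
    (ContinuousCohomology.map _ _ 1 (oneCocycleClass _ z)) = 0 at hmem
  rw [map_oneCocycleClass, resH1Hom_oneCocycleClass_eq_zero_iff] at hmem
  obtain ⟨a, ha⟩ := hmem
  have hx := ha x
  change (σ • z.1 (subgroupConj H σ (inertiaInToH H v x)) : M) =
    (((x : inertiaIn H v) : decomp (K := K) v) : absoluteGaloisGroup K) • a - a at hx
  rw [htriv, htriv, sub_self] at hx
  have hconj : subgroupConj H σ (inertiaInToH H v x) = ⟨m, hmH⟩ := Subtype.ext (by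
    rw [subgroupConj_apply_coe]
    change σ⁻¹ * (σ * m * σ⁻¹) * σ = m
    group)
  rwa [hconj] at hx

/-- **prime-form ⟹ σ-form for the unramified condition.**  If `z` vanishes on `H ∩ I_𝔓` for every prime `𝔓` of `\bar ℤ_K` above `v`
(trivial action), then every conjugate `conj_σ [z]` lies in `unramifiedKer H M v`. [cite: GreenbergVatsal2000, §2 p. 17]
[cite: NeukirchANT1999, Ch. I §9 (9.4)] -/
theorem conjH1_mem_unramifiedKer_of_forall_primesAbove (htriv : ∀ (σ : absoluteGaloisGroup K) (m : M), σ • m = m)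
    (z : contOneCocycles (discreteTopRep H M)) {v : HeightOneSpectrum (𝓞 K)}
    (h : ∀ 𝔓 ∈ v.primesAbove, ∀ (n : absoluteGaloisGroup K) (hnH : n ∈ H),
      n ∈ 𝔓.inertia (absoluteGaloisGroup K) → z.1 ⟨n, hnH⟩ = 0)
    (σ : absoluteGaloisGroup K) : conjH1 H M σ (oneCocycleClass _ z) ∈ unramifiedKer H M v := by
  have e : unramifiedKer H M v = (resH1Hom (inertiaInToH H v) (AddMonoidHom.id M) fun _ _ ↦ rfl).ker := rfl
  rw [e, AddMonoidHom.mem_ker]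
  change resH1Hom (inertiaInToH H v) (AddMonoidHom.id M) _ (ContinuousCohomology.map _ _ 1 (oneCocycleClass _ z)) = 0
  rw [map_oneCocycleClass, resH1Hom_oneCocycleClass_eq_zero_iff]
  refine ⟨0, fun x ↦ ?_⟩
  rw [smul_zero, sub_zero]
  change (σ • z.1 (subgroupConj H σ (inertiaInToH H v x)) : M) = 0
  rw [htriv]
  obtain ⟨hxH, hxI⟩ := (mem_inertiaIn_iff H v _).mp x.2
  -- `σ⁻¹ x σ` lies in the inertia group of the prime `σ⁻¹ 𝔓₀`
  have hmem : σ⁻¹ * ((x : decomp (K := K) v) : absoluteGaloisGroup K) * σ ∈ H := by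
    have h' := ‹H.Normal›.conj_mem _ hxH σ⁻¹
    rwa [inv_inv] at h'
  have hval : subgroupConj H σ (inertiaInToH H v x) =
      ⟨σ⁻¹ * ((x : decomp (K := K) v) : absoluteGaloisGroup K) * σ, hmem⟩ := by
    apply Subtype.ext; rw [subgroupConj_apply_coe]; rfl
  rw [hval]
  refine forall_conj_inertia_of_forall_primesAbove (v := v) (fun m ↦ ∀ hm : m ∈ H, z.1 ⟨m, hm⟩ = 0)
    (fun 𝔓 h𝔓 m hmI hmH ↦ h 𝔓 h𝔓 m hmH hmI) (σ := σ) ?_ _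
  rw [show σ * (σ⁻¹ * ((x : decomp (K := K) v) : absoluteGaloisGroup K) * σ) * σ⁻¹ =
    ((x : decomp (K := K) v) : absoluteGaloisGroup K) by group]
  exact hxI

/-! ## §3. The strict condition at `w` on an explicit cocycle, prime by prime -/

set_option synthInstance.maxHeartbeats 100000 in
-- the pointwise `MulAction` of `Γ_K` on the ideals of `\bar ℤ_K` is found slowly under these imports (as in `…SelmerToHomPrimes`)
/-- **Strict at `w` (Castella's datum) ⟹ `z` kills `H ∩ D_𝔔` for every prime `𝔔` above `w`** (trivial action; via the tree's
`mem_awayKer_of_mem_strictKer_bdpData`). [cite: Greenberg1989, §1 p. 98] [cite: NeukirchANT1999, Ch. I §9 (9.1)] -/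
theorem apply_eq_zero_of_forall_conjH1_mem_strictKer_bdpData (htriv : ∀ (σ : absoluteGaloisGroup K) (m : M), σ • m = m)
    {p : ℕ} (z : contOneCocycles (discreteTopRep H M)) {w : HeightOneSpectrum (𝓞 K)} (hw : ((p : ℕ) : 𝓞 K) ∈ w.asIdeal)
    (h : ∀ σ : absoluteGaloisGroup K, conjH1 H M σ (oneCocycleClass _ z) ∈ (AcSelmer.bdpData M p w w hw).strictKer H)
    {𝔔 : Ideal (absIntegers (𝓞 K) K)} (h𝔔 : 𝔔 ∈ w.primesAbove) {n : absoluteGaloisGroup K} (hnH : n ∈ H)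
    (hn : n ∈ 𝔔.decompositionSubgroup (absoluteGaloisGroup K)) : z.1 ⟨n, hnH⟩ = 0 := by
  revert hnH
  refine forall_primesAbove_decompositionSubgroup_of_forall_conj (v := w) (fun m ↦ ∀ hm : m ∈ H, z.1 ⟨m, hm⟩ = 0) ?_ h𝔔 hn
  intro σ m hσm hmH
  have hxH : σ * m * σ⁻¹ ∈ H := ‹H.Normal›.conj_mem m hmH σ
  have hmem : conjH1 H M σ (oneCocycleClass _ z) ∈ awayKer H M w := mem_awayKer_of_mem_strictKer_bdpData M H htriv hw (h σ)
  rw [awayKer, AddMonoidHom.mem_ker, conjH1_oneCocycleClass_mem_ker_resOfLe_iff] at hmem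
  obtain ⟨a, ha⟩ := hmem
  have hx := ha ⟨σ * m * σ⁻¹, Subgroup.mem_inf.mpr ⟨hxH, hσm⟩⟩
  rw [htriv] at hx
  change _ = (σ * m * σ⁻¹) • a - a at hx
  rw [htriv, sub_self] at hx
  have hconj : subgroupConj H σ (Subgroup.inclusion (inf_le_left : H ⊓ decomp w ≤ H)
      ⟨σ * m * σ⁻¹, Subgroup.mem_inf.mpr ⟨hxH, hσm⟩⟩) = ⟨m, hmH⟩ := Subtype.ext (by
    rw [subgroupConj_apply_coe, Subgroup.coe_inclusion]
    change σ⁻¹ * (σ * m * σ⁻¹) * σ = m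
    group)
  rwa [hconj] at hx

/-! ## §4. Transport of inertia: `res x ∈ I_𝔓 (𝔓 ⊂ \bar ℤ)` ⟹ `x` lies in an inertia group of `\bar ℤ_K` above the same prime -/

omit [H.Normal] in
/-- **Inertia transport `Γ_ℚ → Γ_K`.**  If `z` kills `H ∩ I_𝔓` for every prime `𝔓` of `\bar ℤ_K` above every place of `K` not
containing `p`, then `z x = 0` for every `x ∈ H` whose restriction `res x ∈ Γ_ℚ` lies in the inertia group of a prime of `\bar ℤ`
above a rational place not containing `p` (tree: transport along `absGaloisTransport`, then re-basing the integral closure from `𝓞 ℚ`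
to `𝓞 K`). [cite: NeukirchANT1999, Ch. I §9 (9.4)] -/
theorem apply_eq_zero_of_absGaloisRestrict_mem_inertia {p : ℕ} (z : contOneCocycles (discreteTopRep H M))
    (hz : ∀ u : HeightOneSpectrum (𝓞 K), ((p : ℕ) : 𝓞 K) ∉ u.asIdeal →
      ∀ 𝔓 ∈ u.primesAbove, ∀ (n : absoluteGaloisGroup K) (hnH : n ∈ H), n ∈ 𝔓.inertia (absoluteGaloisGroup K) → z.1 ⟨n, hnH⟩ = 0)
    {u₀ : HeightOneSpectrum (𝓞 ℚ)} (hu₀ : ((p : ℕ) : 𝓞 ℚ) ∉ u₀.asIdeal)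
    {𝔓 : Ideal (absIntegers (𝓞 ℚ) ℚ)} (h𝔓 : 𝔓 ∈ u₀.primesAbove) {x : absoluteGaloisGroup K} (hxH : x ∈ H)
    (hx : absGaloisRestrict ℚ K x ∈ 𝔓.inertia (absoluteGaloisGroup ℚ)) : z.1 ⟨x, hxH⟩ = 0 := by
  obtain ⟨𝔓', h𝔓'p, h𝔓'o, hI⟩ := InertiaTransport.exists_prime_forall_absGaloisTransport_mem_inertia (L := K) h𝔓
  obtain ⟨𝔓₂, w, h𝔓₂p, h𝔓₂o, hwu, hI₂⟩ :=
    InertiaTransport.exists_prime_over_forall_mem_inertia_of_restrictScalars (k := K) (Ω := AlgebraicClosure K) h𝔓'p h𝔓'o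
  have hw : ((p : ℕ) : 𝓞 K) ∉ w.asIdeal := by
    intro hpw
    apply hu₀
    rw [← hwu, Ideal.under_def, Ideal.mem_comap, map_natCast]
    exact hpw
  have hxI : x ∈ 𝔓₂.inertia (absoluteGaloisGroup K) :=
    hI₂ x (absGaloisTransport (K := ℚ) (L := K) (absGaloisRestrict ℚ K x))
      (fun y ↦ (absGaloisTransport_absGaloisRestrict (K := ℚ) (L := K) x y).symm) (hI _ hx)
  exact hz w hw 𝔓₂ (HeightOneSpectrum.mem_primesAbove_iff.mpr ⟨h𝔓₂p, h𝔓₂o⟩) x hxH hxI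

end Summit.BirchSwinnertonDyer.BirchSwinnertonDyer.Theorems.TwoAdicWbarStep

end
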